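import Summits.QuantumFields.YangMills.Theorems.UnitScaleTiltProp7CombSymDiffL1XOfFrameRem2RowsT3
import Summits.QuantumFields.YangMills.Theorems.UnitScaleTiltProp7CombAccFrameMassOfRegPrT3
import Summits.QuantumFields.YangMills.Theorems.UnitScaleTiltProp7HcoSOfNormG0DiffRow
import HarnessLib

/-!
# Route `UnitScaleTilt`, crux K1 «MinimiserStabilityRegPr» (stmt-QuantumFields-19200), route-R E′ (A′)-on-Σ, P-A2 row (β) of ✓p698006 — file «(β)-ASSEMBLY G2½»:
# **THE `hD` BINDER FROM THE COMB TOWER-MASS ROW `hMc` AND THE TWO ONE-TOWER SECOND-ORDER FRAME REMAINDER ROWS «REM2ˢ», «REM2ᶜ»**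

Cell `ym3-torus` (HUMAN RULING D-0037: YM₃ on the torus is ladder rung R3 — not d = 4, not a mass gap, not Clay), width seat `ym3-torus-px16` (gen 5).  `--supports stmt-QuantumFields-19200
--as helper`; THEOREMS ONLY (0 `def`, 0 `sorry`); count-neutral.

WHAT.  ✓p698006 `Prop7PA2OfSymDiffDivRows.hPA2_of_symL1_diffL1_divSlice` (== S30ᴸ ✓p701521) displays ONE open row (β) `hD`: the comb − sym chart-remainder difference in ℓ¹ on the `hcoS`
binder, `Σ_ĉ ‖C^{tw}_W(iX)(ĉ) − C^{twS}_W(iX)(ĉ)‖ ≤ CD₁·ℓ⁻¹·Σ_b‖X b‖² + CD₂·ℓ·(K_W(iX) + DIV_W(iX))` per `(L, B₁′)`.  This file proves `hD` VERBATIM from THREE displayed rows on the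
same binder, each `∀ L > 1, ∀ B₁′ > 0, ∃ (radius, L-only constants), ∀ ⟨binder⟩`:
* `hMc` — the COMB TOWER-MASS ROW («hMcomb», ★routeR-w6 g8 SIGNATURE-0 summand token for token at `A := fun b ↦ I•X b`, in `X`-letters with three constants `A B B′`; ★★OWNER g29
  06:31:31Z (a): «= px16's three-constant `hMc`», supplier lane (II) ★routeR-w1 g9 F-0…F-8, OPEN):
  `∀ l < K − n, Σ_{z,κ} ‖Ũ^{(l)}_{z,κ} − 1‖² ≤ A·M·(Lˡ)⁻¹ + (B·(K + DIV) + B′·(ℓ²)⁻¹·M)·Lˡ`;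
* `hRs` — «REM2ˢ» summed at the chart sites: `Σ_y ‖w^{s}_y(iX) − 1 − Dw^{s}_y(0)(iX)‖ ≤ Cs₁·ℓ⁻¹·M + Cs₂·ℓ·(K + DIV)` (px13 g6 F-β∕F-γ chain ✓p702081 ✓p702558 …, member knit OPEN);
* `hRc` — «REM2ᶜ» the same for the comb frame `w^{c}` (px17 g4 F-αᶜ∕F-βᶜ chain ⟸ «hMcomb₂», OPEN).
Everything else on the way to `hD` is discharged BY NAME: the comb accumulated-frame masses `Φᶜ, Φᶜ⁻¹ ⟸ hMc` (★routeR-w6 ✓p701781 `sum_normSq_frameTw_sub_one_le_of_hMcomb` at `Am := A·M`,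
`Bm := B·(K+DIV) + B′·(ℓ²)⁻¹·M`, `ε₀ := (12B₁′ + 1)·e` by lit ✓`regPr_mono` so that `nMax19 X < 2B₁′e < ε₀∕6`), the symmetric frame mass `Φˢ` (✓p699876), the frame sups and unitarity
(✓`norm_frameTw_sub_one_le_of_regPr`, ✓`norm_dbarTwS_sub_one_le`, ✓px17 `frameTw_mem_unitaryUnits_of_regPr`), the pointwise (R0) row (px13 ✓p699912 `siteRow_of_frameRows`), the (β) door
with (R0) and the masses (✓p700334 G1), the `M₀∕KD → X` exchange (★routeR-w4 ✓p695503) and ★routeR-w3's letter-free ✓`knit_arith` (T := 1, r₁ := 1, r₂ := 2∕L, Φˢ-weight 1662 = 1632 + 30).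

* §1 ★★ `sum_norm_CmapTw_sub_CmapTwS_le_X_of_frameRem2` — member level, `X`-currency: `Λ ≤ 30·Pc′ + 408·Pc + 6·Rs + 6·Rc + CD₁″(L,σ)·ℓ⁻¹·Σ‖D b‖² + CD₂″(L)·ℓ·(K_W(iD) + DIV_W(iD))`
  from the four abstract frame rows `Σ‖w^{c} − 1‖² ≤ Pc′`, `Σ‖(w^{c})⁻¹ − 1‖² ≤ Pc`, REM2ˢ `≤ Rs`, REM2ᶜ `≤ Rc`.
* §2 ★★★ `hD_of_hMcomb_of_rem2Rows (hMc) (hRs) (hRc) : ⟨✓p698006's hD, VERBATIM⟩` — radius `eD := min {eC, eS, eR, T⁻¹}`, `T := 10¹⁴L⁹ + 4·10¹¹L⁹·2B₁′ + 10⁷L⁴(12B₁′ + 1)`.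

HONEST SCOPE.  Bookkeeping∕assembly; the three displayed rows are OPEN (route-internal suppliers named above); nothing of (β)∕hPA2∕hcoS∕E′∕EX∕the crux is proved here; YM₃ on T³ is
rung R3 — NOT d = 4, NOT infinite volume, NOT a mass gap, NOT Clay.
[cite: Balaban1985Variational, (2) p.278, (15) p.280, (19)-(20) p.281, (44)-(48) pp.285-286, (106)-(111) p.294, Prop. 7 p.299; Balaban1985Averaging, (26)-(27) p.22, (89)-(92) p.31, (97) p.32,
(161)-(163) p.42; Balaban1985BackgroundPropagators, (3.3)-(3.8) pp.391-392]
-/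

noncomputable section

open scoped BigOperators Matrix.Norms.L2Operator Matrix Topology InnerProductSpace
open Filter NormedSpace

namespace Summit.QuantumFields.YangMills.Theorems.Prop7HDOfCombRowRem2Rows

open Literature.MathematicalPhysics.QuantumFieldTheory.Balaban1983to89
open Literature.MathematicalPhysics.QuantumFieldTheory.Balaban1983to89.T3ContinuumYM3Torus
open Literature.MathematicalPhysics.QuantumFieldTheory.Balaban1983to89.T3UnitLawDensityEML (ℰp)
open Literature.MathematicalPhysics.QuantumFieldTheory.Balaban1983to89.T3ConstrainedMinimiser (fibre)
open Literature.MathematicalPhysics.QuantumFieldTheory.Balaban1983to89.T3PrintedRegularMinimiser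
open Literature.MathematicalPhysics.QuantumFieldTheory.Balaban1983to89.T3PrintedMinimiserExistence (regPr_mono)
open Literature.MathematicalPhysics.QuantumFieldTheory.Balaban1983to89.T3RegularMinimiser
open Literature.MathematicalPhysics.QuantumFieldTheory.Balaban1983to89.T3Thm1Carrier
open MatrixLog (mlog)
open T4Continuum BlockAveraging AveragingRT ExpMeanLog BlockAveragingEMLLinearised BlockAveragingEMLLinearisedBackground BlockAveragingEMLProp2
open B7Prop1Explicit (expUnit val_expUnit)
open B7Eq92Concrete (tildIter)
open B10Eq27TorusAxialLog (pull unitsField toUField)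
open B9Eq39Adjoint (divB)
open B9TorusCalculus (torusT)
open Summit.QuantumFields.YangMills.Theorems.Prop7CombSymDiffL1XOfFrameRem2Rows (sum_norm_CmapTw_sub_CmapTwS_le_X_of_frameRem2)
open T3SectALandauChart (emb15 eta eta_pos bgUnits In19 pos_of_regPr)
open B11Eq103H1Complex (BondL2K laplaceAK)
open Summit.QuantumFields.YangMills.Theorems.Prop7SPrint (basePt RestrictedPrint AvgCondPrint IsLandauPrint)
open Summit.QuantumFields.YangMills.Theorems.Prop7SPrintIn19 (pow_mul_eta)
open Summit.QuantumFields.YangMills.Theorems.Prop7TPrint (expHermField nMax19 nMax19_lt_iff)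
open Summit.QuantumFields.YangMills.Theorems.Prop7SymAvgTw (frameTw QTw CmapTw)
open Summit.QuantumFields.YangMills.Theorems.Prop7SymAvgTwSym (frameTwS dbarTwS CmapTwS)
open Summit.QuantumFields.YangMills.Theorems.Prop7CombAccFrameMassOfRegPr (sum_normSq_frameTw_sub_one_le_of_hMcomb)
open Summit.QuantumFields.YangMills.Theorems.Prop7HcoSEndToEnd (summand_window)

variable (F : T3Family) (n K : ℕ)

/-! ## §2 The `hD` binder from `hMc`, «REM2ˢ», «REM2ᶜ» -/

/-- ★★★ **✓p698006's (β) ROW `hD` FROM THE COMB TOWER-MASS ROW AND THE TWO SECOND-ORDER FRAME REMAINDER ROWS** — conclusion = the `hD` binder of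
✓`Prop7PA2OfSymDiffDivRows.hPA2_of_symL1_diffL1_divSlice` VERBATIM; hypotheses = three displayed OPEN rows on the same binder (docstring above): `hMc` («hMcomb» in `X`-letters, three
constants), `hRs` («REM2ˢ»), `hRc` («REM2ᶜ»).  Radius `eD := min (min eC (min eS eR)) T⁻¹`, `T := 10¹⁴L⁹ + 4·10¹¹L⁹·(2B₁′) + 10⁷L⁴·(12B₁′ + 1)`; per member `ε₀ := e` for §1 and
`ε₀ := (12B₁′ + 1)·e` for ★routeR-w6's F3b (lit ✓`regPr_mono`; `nMax19 X < 2B₁′e < ε₀∕6`), `σ := (4·10¹¹L⁹)⁻¹`.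
[cite: Balaban1985Variational, (2) p.278, (19)-(20) p.281, (44)-(48) pp.285-286, (106)-(111) p.294; Balaban1985Averaging, (89)-(92) p.31, (97) p.32] -/
theorem hD_of_hMcomb_of_rem2Rows
    (hMc : ∀ (L : ℕ), 1 < L → ∀ (B₁' : ℝ), 0 < B₁' → ∃ eC A B B' : ℝ, 0 < eC ∧ 0 ≤ A ∧ 0 ≤ B ∧ 0 ≤ B' ∧
      ∀ (F : T3Family), F.L = L → ∀ (n K : ℕ) (hnK : n < K) (e : ℝ) (V : GaugeField (F.P n) 0 (Matrix.specialUnitaryGroup (Fin 2) ℂ))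
        (W : GaugeField (F.P K) 0 (Matrix.specialUnitaryGroup (Fin 2) ℂ)) (X : PBond (F.P K) 0 → Matrix (Fin 2) (Fin 2) ℂ),
        0 < e → e ≤ eC → W ∈ regFibrePr F n K hnK.le e V →
        (∀ γ : ℝ → GaugeField (F.P K) 0 (Matrix.specialUnitaryGroup (Fin 2) ℂ), γ 0 = W → (∀ t, γ t ∈ fibre F ℰp n K hnK.le V) →
          (∀ b, DifferentiableAt ℝ (fun t => ((γ t b : Matrix.specialUnitaryGroup (Fin 2) ℂ) : Matrix (Fin 2) (Fin 2) ℂ)) 0) →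
            deriv (fun t => wilsonAction4 (γ t)) 0 = 0) →
        In19 F n K (2 * B₁' * e) W (expHermField X) X → AvgCondPrint F n K hnK.le V W X → IsLandauPrint F n K W X →
          ∀ l : ℕ, l < K - n →
            ∑ z : Site (F.P K) l, ∑ κ : Fin (F.P K).d,
              ‖((tildIter (F.P K).L (pull (bgUnits F K W) (basePt F n K)) (pull (fun b => expUnit (Complex.I • X b)) (basePt F n K)) l
              (fun μ => ((z μ).val : ℤ)) κ : (Matrix (Fin 2) (Fin 2) ℂ)ˣ) : Matrix (Fin 2) (Fin 2) ℂ) - 1‖ ^ 2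
              ≤ A * (∑ b : PBond (F.P K) 0, ‖X b‖ ^ 2) * ((F.L : ℝ) ^ l)⁻¹
                + (B * ((∑ p : Plaq (F.P K) 0, ‖((Complex.I • X ⟨p.src, p.μ⟩) + ((W ⟨p.src, p.μ⟩ : Matrix (Fin 2) (Fin 2) ℂ) * (Complex.I • X ⟨p.src.shift p.μ, p.ν⟩) * star (W ⟨p.src, p.μ⟩ : Matrix (Fin 2) (Fin 2) ℂ))
            - (((W ⟨p.src, p.μ⟩ * W ⟨p.src.shift p.μ, p.ν⟩ * (W ⟨p.src.shift p.ν, p.μ⟩)⁻¹ : Matrix.specialUnitaryGroup (Fin 2) ℂ) : Matrix (Fin 2) (Fin 2) ℂ) * (Complex.I • X ⟨p.src.shift p.ν, p.μ⟩) * star ((W ⟨p.src, p.μ⟩ * W ⟨p.src.shift p.μ, p.ν⟩ * (W ⟨p.src.shift p.ν, p.μ⟩)⁻¹ : Matrix.specialUnitaryGroup (Fin 2) ℂ) : Matrix (Fin 2) (Fin 2) ℂ))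
            - (((GaugeField.plaqHol W p : Matrix.specialUnitaryGroup (Fin 2) ℂ) : Matrix (Fin 2) (Fin 2) ℂ) * (Complex.I • X ⟨p.src, p.ν⟩) * star ((GaugeField.plaqHol W p : Matrix.specialUnitaryGroup (Fin 2) ℂ) : Matrix (Fin 2) (Fin 2) ℂ)))‖ ^ 2) + (∑ x : Site (F.P K) 0, ∑ j : Fin 2, ∑ k : Fin 2,
              ‖(divB (torusT (F.P K) 0) (fun κ z => unitsField (toUField W) ⟨z, κ⟩) (fun κ z => Complex.I • X ⟨z, κ⟩) x) j k‖ ^ 2))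
                  + B' * (((F.L : ℝ) ^ (K - n)) ^ 2)⁻¹ * (∑ b : PBond (F.P K) 0, ‖X b‖ ^ 2)) * (F.L : ℝ) ^ l)
    (hRs : ∀ (L : ℕ), 1 < L → ∀ (B₁' : ℝ), 0 < B₁' → ∃ eS Cs₁ Cs₂ : ℝ, 0 < eS ∧ 0 ≤ Cs₁ ∧ 0 ≤ Cs₂ ∧
      ∀ (F : T3Family), F.L = L → ∀ (n K : ℕ) (hnK : n < K) (e : ℝ) (V : GaugeField (F.P n) 0 (Matrix.specialUnitaryGroup (Fin 2) ℂ))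
        (W : GaugeField (F.P K) 0 (Matrix.specialUnitaryGroup (Fin 2) ℂ)) (X : PBond (F.P K) 0 → Matrix (Fin 2) (Fin 2) ℂ),
        0 < e → e ≤ eS → W ∈ regFibrePr F n K hnK.le e V →
        (∀ γ : ℝ → GaugeField (F.P K) 0 (Matrix.specialUnitaryGroup (Fin 2) ℂ), γ 0 = W → (∀ t, γ t ∈ fibre F ℰp n K hnK.le V) →
          (∀ b, DifferentiableAt ℝ (fun t => ((γ t b : Matrix.specialUnitaryGroup (Fin 2) ℂ) : Matrix (Fin 2) (Fin 2) ℂ)) 0) →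
            deriv (fun t => wilsonAction4 (γ t)) 0 = 0) →
        In19 F n K (2 * B₁' * e) W (expHermField X) X → AvgCondPrint F n K hnK.le V W X → IsLandauPrint F n K W X →
          ∑ y : Site (F.P n) 0, ‖((frameTwS F n K hnK.le W (fun b => Complex.I • X b) y : (Matrix (Fin 2) (Fin 2) ℂ)ˣ) : Matrix (Fin 2) (Fin 2) ℂ) - 1
            - fderiv ℂ (fun A : PBond (F.P K) 0 → Matrix (Fin 2) (Fin 2) ℂ => ((frameTwS F n K hnK.le W A y : (Matrix (Fin 2) (Fin 2) ℂ)ˣ) : Matrix (Fin 2) (Fin 2) ℂ)) 0 (fun b => Complex.I • X b)‖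
            ≤ Cs₁ * ((F.L : ℝ) ^ (K - n))⁻¹ * (∑ b : PBond (F.P K) 0, ‖X b‖ ^ 2) + Cs₂ * ((F.L : ℝ) ^ (K - n)) * ((∑ p : Plaq (F.P K) 0, ‖((Complex.I • X ⟨p.src, p.μ⟩) + ((W ⟨p.src, p.μ⟩ : Matrix (Fin 2) (Fin 2) ℂ) * (Complex.I • X ⟨p.src.shift p.μ, p.ν⟩) * star (W ⟨p.src, p.μ⟩ : Matrix (Fin 2) (Fin 2) ℂ))
            - (((W ⟨p.src, p.μ⟩ * W ⟨p.src.shift p.μ, p.ν⟩ * (W ⟨p.src.shift p.ν, p.μ⟩)⁻¹ : Matrix.specialUnitaryGroup (Fin 2) ℂ) : Matrix (Fin 2) (Fin 2) ℂ) * (Complex.I • X ⟨p.src.shift p.ν, p.μ⟩) * star ((W ⟨p.src, p.μ⟩ * W ⟨p.src.shift p.μ, p.ν⟩ * (W ⟨p.src.shift p.ν, p.μ⟩)⁻¹ : Matrix.specialUnitaryGroup (Fin 2) ℂ) : Matrix (Fin 2) (Fin 2) ℂ))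
            - (((GaugeField.plaqHol W p : Matrix.specialUnitaryGroup (Fin 2) ℂ) : Matrix (Fin 2) (Fin 2) ℂ) * (Complex.I • X ⟨p.src, p.ν⟩) * star ((GaugeField.plaqHol W p : Matrix.specialUnitaryGroup (Fin 2) ℂ) : Matrix (Fin 2) (Fin 2) ℂ)))‖ ^ 2) + (∑ x : Site (F.P K) 0, ∑ j : Fin 2, ∑ k : Fin 2,
              ‖(divB (torusT (F.P K) 0) (fun κ z => unitsField (toUField W) ⟨z, κ⟩) (fun κ z => Complex.I • X ⟨z, κ⟩) x) j k‖ ^ 2)))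
    (hRc : ∀ (L : ℕ), 1 < L → ∀ (B₁' : ℝ), 0 < B₁' → ∃ eR Cc₁ Cc₂ : ℝ, 0 < eR ∧ 0 ≤ Cc₁ ∧ 0 ≤ Cc₂ ∧
      ∀ (F : T3Family), F.L = L → ∀ (n K : ℕ) (hnK : n < K) (e : ℝ) (V : GaugeField (F.P n) 0 (Matrix.specialUnitaryGroup (Fin 2) ℂ))
        (W : GaugeField (F.P K) 0 (Matrix.specialUnitaryGroup (Fin 2) ℂ)) (X : PBond (F.P K) 0 → Matrix (Fin 2) (Fin 2) ℂ),
        0 < e → e ≤ eR → W ∈ regFibrePr F n K hnK.le e V →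
        (∀ γ : ℝ → GaugeField (F.P K) 0 (Matrix.specialUnitaryGroup (Fin 2) ℂ), γ 0 = W → (∀ t, γ t ∈ fibre F ℰp n K hnK.le V) →
          (∀ b, DifferentiableAt ℝ (fun t => ((γ t b : Matrix.specialUnitaryGroup (Fin 2) ℂ) : Matrix (Fin 2) (Fin 2) ℂ)) 0) →
            deriv (fun t => wilsonAction4 (γ t)) 0 = 0) →
        In19 F n K (2 * B₁' * e) W (expHermField X) X → AvgCondPrint F n K hnK.le V W X → IsLandauPrint F n K W X →
          ∑ y : Site (F.P n) 0, ‖((frameTw F n K hnK.le W (fun b => Complex.I • X b) y : (Matrix (Fin 2) (Fin 2) ℂ)ˣ) : Matrix (Fin 2) (Fin 2) ℂ) - 1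
            - fderiv ℂ (fun A : PBond (F.P K) 0 → Matrix (Fin 2) (Fin 2) ℂ => ((frameTw F n K hnK.le W A y : (Matrix (Fin 2) (Fin 2) ℂ)ˣ) : Matrix (Fin 2) (Fin 2) ℂ)) 0 (fun b => Complex.I • X b)‖
            ≤ Cc₁ * ((F.L : ℝ) ^ (K - n))⁻¹ * (∑ b : PBond (F.P K) 0, ‖X b‖ ^ 2) + Cc₂ * ((F.L : ℝ) ^ (K - n)) * ((∑ p : Plaq (F.P K) 0, ‖((Complex.I • X ⟨p.src, p.μ⟩) + ((W ⟨p.src, p.μ⟩ : Matrix (Fin 2) (Fin 2) ℂ) * (Complex.I • X ⟨p.src.shift p.μ, p.ν⟩) * star (W ⟨p.src, p.μ⟩ : Matrix (Fin 2) (Fin 2) ℂ))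
            - (((W ⟨p.src, p.μ⟩ * W ⟨p.src.shift p.μ, p.ν⟩ * (W ⟨p.src.shift p.ν, p.μ⟩)⁻¹ : Matrix.specialUnitaryGroup (Fin 2) ℂ) : Matrix (Fin 2) (Fin 2) ℂ) * (Complex.I • X ⟨p.src.shift p.ν, p.μ⟩) * star ((W ⟨p.src, p.μ⟩ * W ⟨p.src.shift p.μ, p.ν⟩ * (W ⟨p.src.shift p.ν, p.μ⟩)⁻¹ : Matrix.specialUnitaryGroup (Fin 2) ℂ) : Matrix (Fin 2) (Fin 2) ℂ))
            - (((GaugeField.plaqHol W p : Matrix.specialUnitaryGroup (Fin 2) ℂ) : Matrix (Fin 2) (Fin 2) ℂ) * (Complex.I • X ⟨p.src, p.ν⟩) * star ((GaugeField.plaqHol W p : Matrix.specialUnitaryGroup (Fin 2) ℂ) : Matrix (Fin 2) (Fin 2) ℂ)))‖ ^ 2) + (∑ x : Site (F.P K) 0, ∑ j : Fin 2, ∑ k : Fin 2,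
              ‖(divB (torusT (F.P K) 0) (fun κ z => unitsField (toUField W) ⟨z, κ⟩) (fun κ z => Complex.I • X ⟨z, κ⟩) x) j k‖ ^ 2))) :
    ∀ (L : ℕ), 1 < L → ∀ (B₁' : ℝ), 0 < B₁' → ∃ eD CD₁ CD₂ : ℝ, 0 < eD ∧ 0 ≤ CD₁ ∧ 0 ≤ CD₂ ∧
      ∀ (F : T3Family), F.L = L → ∀ (n K : ℕ) (hnK : n < K) (e : ℝ) (V : GaugeField (F.P n) 0 (Matrix.specialUnitaryGroup (Fin 2) ℂ))
        (W : GaugeField (F.P K) 0 (Matrix.specialUnitaryGroup (Fin 2) ℂ)) (X : PBond (F.P K) 0 → Matrix (Fin 2) (Fin 2) ℂ),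
        0 < e → e ≤ eD → W ∈ regFibrePr F n K hnK.le e V →
        (∀ γ : ℝ → GaugeField (F.P K) 0 (Matrix.specialUnitaryGroup (Fin 2) ℂ), γ 0 = W → (∀ t, γ t ∈ fibre F ℰp n K hnK.le V) →
          (∀ b, DifferentiableAt ℝ (fun t => ((γ t b : Matrix.specialUnitaryGroup (Fin 2) ℂ) : Matrix (Fin 2) (Fin 2) ℂ)) 0) →
            deriv (fun t => wilsonAction4 (γ t)) 0 = 0) →
        In19 F n K (2 * B₁' * e) W (expHermField X) X → AvgCondPrint F n K hnK.le V W X → IsLandauPrint F n K W X →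
          ∑ ĉ : PBond (F.P n) 0, ‖CmapTw F n K hnK.le W (fun b => Complex.I • X b) ĉ - CmapTwS F n K hnK.le W (fun b => Complex.I • X b) ĉ‖
              ≤ CD₁ * ((F.L : ℝ) ^ (K - n))⁻¹ * (∑ b : PBond (F.P K) 0, ‖X b‖ ^ 2) + CD₂ * ((F.L : ℝ) ^ (K - n)) * ((∑ p : Plaq (F.P K) 0, ‖((Complex.I • X ⟨p.src, p.μ⟩) + ((W ⟨p.src, p.μ⟩ : Matrix (Fin 2) (Fin 2) ℂ) * (Complex.I • X ⟨p.src.shift p.μ, p.ν⟩) * star (W ⟨p.src, p.μ⟩ : Matrix (Fin 2) (Fin 2) ℂ))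
            - (((W ⟨p.src, p.μ⟩ * W ⟨p.src.shift p.μ, p.ν⟩ * (W ⟨p.src.shift p.ν, p.μ⟩)⁻¹ : Matrix.specialUnitaryGroup (Fin 2) ℂ) : Matrix (Fin 2) (Fin 2) ℂ) * (Complex.I • X ⟨p.src.shift p.ν, p.μ⟩) * star ((W ⟨p.src, p.μ⟩ * W ⟨p.src.shift p.μ, p.ν⟩ * (W ⟨p.src.shift p.ν, p.μ⟩)⁻¹ : Matrix.specialUnitaryGroup (Fin 2) ℂ) : Matrix (Fin 2) (Fin 2) ℂ))
            - (((GaugeField.plaqHol W p : Matrix.specialUnitaryGroup (Fin 2) ℂ) : Matrix (Fin 2) (Fin 2) ℂ) * (Complex.I • X ⟨p.src, p.ν⟩) * star ((GaugeField.plaqHol W p : Matrix.specialUnitaryGroup (Fin 2) ℂ) : Matrix (Fin 2) (Fin 2) ℂ)))‖ ^ 2) + (∑ x : Site (F.P K) 0, ∑ j : Fin 2, ∑ k : Fin 2,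
              ‖(divB (torusT (F.P K) 0) (fun κ z => unitsField (toUField W) ⟨z, κ⟩) (fun κ z => Complex.I • X ⟨z, κ⟩) x) j k‖ ^ 2)) := by
  intro L hL B₁' hB₁'
  obtain ⟨eC, A, B, B', heC, hA0, hB0, hB'0, hMcL⟩ := hMc L hL B₁' hB₁'
  obtain ⟨eS, Cs₁, Cs₂, heS, hCs₁, hCs₂, hRsL⟩ := hRs L hL B₁' hB₁'
  obtain ⟨eR, Cc₁, Cc₂, heR, hCc₁, hCc₂, hRcL⟩ := hRc L hL B₁' hB₁'
  have hL0 : (0 : ℝ) < (L : ℝ) := by exact_mod_cast (show 0 < L by omega)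
  obtain ⟨T, hT_def⟩ : ∃ T : ℝ, T = 100000000000000 * (L : ℝ) ^ 9 + 400000000000 * (L : ℝ) ^ 9 * (2 * B₁') + 10 ^ 7 * (L : ℝ) ^ 4 * (12 * B₁' + 1) := ⟨_, rfl⟩
  have t1 : (0 : ℝ) ≤ 100000000000000 * (L : ℝ) ^ 9 := by positivity
  have t2 : (0 : ℝ) ≤ 400000000000 * (L : ℝ) ^ 9 * (2 * B₁') := by positivity
  have t3 : (0 : ℝ) ≤ 10 ^ 7 * (L : ℝ) ^ 4 * (12 * B₁' + 1) := by positivity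
  have hTpos : 0 < T := by rw [hT_def]; positivity
  -- the σ of §1
  obtain ⟨σ, hσ_def⟩ : ∃ σ : ℝ, σ = (400000000000 * (L : ℝ) ^ 9)⁻¹ := ⟨_, rfl⟩
  have hc0 : (0 : ℝ) < 400000000000 * (L : ℝ) ^ 9 := by positivity
  have hσ0 : 0 ≤ σ := by rw [hσ_def]; positivity
  refine ⟨min (min eC (min eS eR)) T⁻¹,
    30 * (220 * (L : ℝ) ^ 3 * A + 110 * (L : ℝ) ^ 2 * B') + 408 * (220 * (L : ℝ) ^ 3 * A + 110 * (L : ℝ) ^ 2 * B') + 6 * Cs₁ + 6 * Cc₁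
      + (1 * (2 * (L : ℝ) * (1662 * 560 * (L : ℝ) ^ 3 + 56 * (21 + 10080 * (L : ℝ) ^ 3)) + 2 / (L : ℝ) * (((1662 * (40 * (L : ℝ) ^ 2) + 56 * (3 + 720 * (L : ℝ) ^ 2)) * (28800 * (L : ℝ) ^ 4) * ((L : ℝ) / 2)) * (384 + 60 * σ ^ 2) + ((1662 * (40 * (L : ℝ) ^ 2) + 56 * (3 + 720 * (L : ℝ) ^ 2)) * (600000 * (L : ℝ) ^ 4) * ((L : ℝ) / 2))))),
    30 * (110 * (L : ℝ) ^ 2 * B) + 408 * (110 * (L : ℝ) ^ 2 * B) + 6 * Cs₂ + 6 * Cc₂ + (1 * (2 / (L : ℝ) * (8 * ((1662 * (40 * (L : ℝ) ^ 2) + 56 * (3 + 720 * (L : ℝ) ^ 2)) * (28800 * (L : ℝ) ^ 4) * ((L : ℝ) / 2))))),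
    lt_min (lt_min heC (lt_min heS heR)) (inv_pos.mpr hTpos), by positivity, by positivity, ?_⟩
  intro F hF n K hnK e V W X he heD hWreg hEL h19 h20 h21
  -- radius bookkeeping
  have heC' : e ≤ eC := heD.trans ((min_le_left _ _).trans (min_le_left _ _))
  have heS' : e ≤ eS := heD.trans ((min_le_left _ _).trans ((min_le_right _ _).trans (min_le_left _ _)))
  have heR' : e ≤ eR := heD.trans ((min_le_left _ _).trans ((min_le_right _ _).trans (min_le_right _ _)))
  have heT : e ≤ T⁻¹ := heD.trans (min_le_right _ _)
  have hTe : T * e ≤ 1 := by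
    calc T * e ≤ T * T⁻¹ := mul_le_mul_of_nonneg_left heT hTpos.le
      _ = 1 := mul_inv_cancel₀ hTpos.ne'
  have w1 : 100000000000000 * (L : ℝ) ^ 9 * e ≤ 1 := summand_window (by rw [hT_def]; linarith) he.le hTe
  have w3 : 400000000000 * (L : ℝ) ^ 9 * (2 * B₁') * e ≤ 1 := summand_window (by rw [hT_def]; linarith) he.le hTe
  have w4 : 10 ^ 7 * (L : ℝ) ^ 4 * (12 * B₁' + 1) * e ≤ 1 := summand_window (by rw [hT_def]; linarith) he.le hTe
  -- the three rows at this member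
  have hMcM := hMcL F hF n K hnK e V W X he heC' hWreg hEL h19 h20 h21
  have hRsM := hRsL F hF n K hnK e V W X he heS' hWreg hEL h19 h20 h21
  have hRcM := hRcL F hF n K hnK e V W X he heR' hWreg hEL h19 h20 h21
  subst hF
  obtain ⟨-, hreg⟩ := (mem_regFibrePr_iff F).mp hWreg
  have hL3 : (3 : ℝ) ≤ F.L := Prop7CurvedLandauKnitT3.three_le_L F
  have hL1 : (1 : ℝ) ≤ F.L := by linarith
  have hℓ1 : (1 : ℝ) ≤ (F.L : ℝ) ^ (K - n) := one_le_pow₀ hL1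
  have hℓ0 : (0 : ℝ) < (F.L : ℝ) ^ (K - n) := by positivity
  have hη : eta F n K = ((F.L : ℝ) ^ (K - n))⁻¹ := by rw [eta, inv_pow]
  have hD : ∀ b : PBond (F.P K) 0, (X b).IsHermitian ∧ Matrix.trace (X b) = 0 := h19.1
  -- §1's sup datum: `‖X b‖ < 2B₁′e·η ≤ σ·ℓ⁻¹`
  have hσL : 400000000000 * (F.L : ℝ) ^ 9 * σ ≤ 1 := by rw [hσ_def, mul_inv_cancel₀ hc0.ne']
  have hsmallσ : 2 * B₁' * e ≤ σ := by
    have hrew : 2 * B₁' * e = σ * (400000000000 * (F.L : ℝ) ^ 9 * (2 * B₁') * e) := by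
      rw [hσ_def]; field_simp
    rw [hrew]
    exact mul_le_of_le_one_right hσ0 w3
  have hs : ∀ b : PBond (F.P K) 0, ‖X b‖ ≤ σ * ((F.L : ℝ) ^ (K - n))⁻¹ := by
    intro b
    have hb := (h19.2.2.1 b).le
    rw [hη] at hb
    exact hb.trans (mul_le_mul_of_nonneg_right hsmallσ (by positivity))
  -- F3b (★routeR-w6 ✓p701781) at `ε₀ := (12B₁′ + 1)·e`
  have h12 : 0 < (12 * B₁' + 1) * e := by positivity
  have hreg12 : RegPr F n K ((12 * B₁' + 1) * e) W := regPr_mono F (by nlinarith) hreg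
  have hε7 : 10 ^ 7 * (F.L : ℝ) ^ 4 * ((12 * B₁' + 1) * e) ≤ 1 := by
    calc 10 ^ 7 * (F.L : ℝ) ^ 4 * ((12 * B₁' + 1) * e) = 10 ^ 7 * (F.L : ℝ) ^ 4 * (12 * B₁' + 1) * e := by ring
      _ ≤ 1 := w4
  have hX6 : nMax19 F n K W X < (12 * B₁' + 1) * e / 6 := by
    have hlt : nMax19 F n K W X < 2 * B₁' * e :=
      (nMax19_lt_iff (F := F) (n := n) (K := K)).mpr ⟨h19.2.2.1, h19.2.2.2.1, h19.2.2.2.2.1, h19.2.2.2.2.2⟩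
    have : 2 * B₁' * e ≤ (12 * B₁' + 1) * e / 6 := by nlinarith
    exact hlt.trans_le this
  have hM0 : 0 ≤ (∑ b : PBond (F.P K) 0, ‖X b‖ ^ 2) := Finset.sum_nonneg fun _ _ => sq_nonneg _
  have hKD0 : 0 ≤ ((∑ p : Plaq (F.P K) 0, ‖((Complex.I • X ⟨p.src, p.μ⟩) + ((W ⟨p.src, p.μ⟩ : Matrix (Fin 2) (Fin 2) ℂ) * (Complex.I • X ⟨p.src.shift p.μ, p.ν⟩) * star (W ⟨p.src, p.μ⟩ : Matrix (Fin 2) (Fin 2) ℂ))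
            - (((W ⟨p.src, p.μ⟩ * W ⟨p.src.shift p.μ, p.ν⟩ * (W ⟨p.src.shift p.ν, p.μ⟩)⁻¹ : Matrix.specialUnitaryGroup (Fin 2) ℂ) : Matrix (Fin 2) (Fin 2) ℂ) * (Complex.I • X ⟨p.src.shift p.ν, p.μ⟩) * star ((W ⟨p.src, p.μ⟩ * W ⟨p.src.shift p.μ, p.ν⟩ * (W ⟨p.src.shift p.ν, p.μ⟩)⁻¹ : Matrix.specialUnitaryGroup (Fin 2) ℂ) : Matrix (Fin 2) (Fin 2) ℂ))
            - (((GaugeField.plaqHol W p : Matrix.specialUnitaryGroup (Fin 2) ℂ) : Matrix (Fin 2) (Fin 2) ℂ) * (Complex.I • X ⟨p.src, p.ν⟩) * star ((GaugeField.plaqHol W p : Matrix.specialUnitaryGroup (Fin 2) ℂ) : Matrix (Fin 2) (Fin 2) ℂ)))‖ ^ 2) + (∑ x : Site (F.P K) 0, ∑ j : Fin 2, ∑ k : Fin 2,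
              ‖(divB (torusT (F.P K) 0) (fun κ z => unitsField (toUField W) ⟨z, κ⟩) (fun κ z => Complex.I • X ⟨z, κ⟩) x) j k‖ ^ 2)) :=
    add_nonneg (Finset.sum_nonneg fun _ _ => sq_nonneg _)
      (Finset.sum_nonneg fun _ _ => Finset.sum_nonneg fun _ _ => Finset.sum_nonneg fun _ _ => sq_nonneg _)
  have hAm : 0 ≤ A * (∑ b : PBond (F.P K) 0, ‖X b‖ ^ 2) := mul_nonneg hA0 hM0
  have hBm : 0 ≤ B * ((∑ p : Plaq (F.P K) 0, ‖((Complex.I • X ⟨p.src, p.μ⟩) + ((W ⟨p.src, p.μ⟩ : Matrix (Fin 2) (Fin 2) ℂ) * (Complex.I • X ⟨p.src.shift p.μ, p.ν⟩) * star (W ⟨p.src, p.μ⟩ : Matrix (Fin 2) (Fin 2) ℂ))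
            - (((W ⟨p.src, p.μ⟩ * W ⟨p.src.shift p.μ, p.ν⟩ * (W ⟨p.src.shift p.ν, p.μ⟩)⁻¹ : Matrix.specialUnitaryGroup (Fin 2) ℂ) : Matrix (Fin 2) (Fin 2) ℂ) * (Complex.I • X ⟨p.src.shift p.ν, p.μ⟩) * star ((W ⟨p.src, p.μ⟩ * W ⟨p.src.shift p.μ, p.ν⟩ * (W ⟨p.src.shift p.ν, p.μ⟩)⁻¹ : Matrix.specialUnitaryGroup (Fin 2) ℂ) : Matrix (Fin 2) (Fin 2) ℂ))
            - (((GaugeField.plaqHol W p : Matrix.specialUnitaryGroup (Fin 2) ℂ) : Matrix (Fin 2) (Fin 2) ℂ) * (Complex.I • X ⟨p.src, p.ν⟩) * star ((GaugeField.plaqHol W p : Matrix.specialUnitaryGroup (Fin 2) ℂ) : Matrix (Fin 2) (Fin 2) ℂ)))‖ ^ 2) + (∑ x : Site (F.P K) 0, ∑ j : Fin 2, ∑ k : Fin 2,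
              ‖(divB (torusT (F.P K) 0) (fun κ z => unitsField (toUField W) ⟨z, κ⟩) (fun κ z => Complex.I • X ⟨z, κ⟩) x) j k‖ ^ 2))
                  + B' * (((F.L : ℝ) ^ (K - n)) ^ 2)⁻¹ * (∑ b : PBond (F.P K) 0, ‖X b‖ ^ 2) :=
    add_nonneg (mul_nonneg hB0 hKD0) (mul_nonneg (mul_nonneg hB'0 (inv_nonneg.mpr (sq_nonneg _))) hM0)
  have hF3b := sum_normSq_frameTw_sub_one_le_of_hMcomb F hnK.le h12 hε7 W hreg12 X hD hX6 hAm hBm hMcM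
  -- collect: `(ℓ²)⁻¹·M·ℓ = ℓ⁻¹·M`
  have hinv : (((F.L : ℝ) ^ (K - n)) ^ 2)⁻¹ * (F.L : ℝ) ^ (K - n) = ((F.L : ℝ) ^ (K - n))⁻¹ := by
    rw [pow_two, mul_inv, mul_assoc, inv_mul_cancel₀ hℓ0.ne', mul_one]
  have hPc_shape : (220 * (F.L : ℝ) ^ 3 * (A * (∑ b : PBond (F.P K) 0, ‖X b‖ ^ 2)) * ((F.L : ℝ) ^ (K - n))⁻¹ + 110 * (F.L : ℝ) ^ 2 * (B * ((∑ p : Plaq (F.P K) 0, ‖((Complex.I • X ⟨p.src, p.μ⟩) + ((W ⟨p.src, p.μ⟩ : Matrix (Fin 2) (Fin 2) ℂ) * (Complex.I • X ⟨p.src.shift p.μ, p.ν⟩) * star (W ⟨p.src, p.μ⟩ : Matrix (Fin 2) (Fin 2) ℂ))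
            - (((W ⟨p.src, p.μ⟩ * W ⟨p.src.shift p.μ, p.ν⟩ * (W ⟨p.src.shift p.ν, p.μ⟩)⁻¹ : Matrix.specialUnitaryGroup (Fin 2) ℂ) : Matrix (Fin 2) (Fin 2) ℂ) * (Complex.I • X ⟨p.src.shift p.ν, p.μ⟩) * star ((W ⟨p.src, p.μ⟩ * W ⟨p.src.shift p.μ, p.ν⟩ * (W ⟨p.src.shift p.ν, p.μ⟩)⁻¹ : Matrix.specialUnitaryGroup (Fin 2) ℂ) : Matrix (Fin 2) (Fin 2) ℂ))
            - (((GaugeField.plaqHol W p : Matrix.specialUnitaryGroup (Fin 2) ℂ) : Matrix (Fin 2) (Fin 2) ℂ) * (Complex.I • X ⟨p.src, p.ν⟩) * star ((GaugeField.plaqHol W p : Matrix.specialUnitaryGroup (Fin 2) ℂ) : Matrix (Fin 2) (Fin 2) ℂ)))‖ ^ 2) + (∑ x : Site (F.P K) 0, ∑ j : Fin 2, ∑ k : Fin 2,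
              ‖(divB (torusT (F.P K) 0) (fun κ z => unitsField (toUField W) ⟨z, κ⟩) (fun κ z => Complex.I • X ⟨z, κ⟩) x) j k‖ ^ 2)) + B' * (((F.L : ℝ) ^ (K - n)) ^ 2)⁻¹ * (∑ b : PBond (F.P K) 0, ‖X b‖ ^ 2)) * (F.L : ℝ) ^ (K - n))
      = (220 * (F.L : ℝ) ^ 3 * A + 110 * (F.L : ℝ) ^ 2 * B') * ((F.L : ℝ) ^ (K - n))⁻¹ * (∑ b : PBond (F.P K) 0, ‖X b‖ ^ 2)
        + 110 * (F.L : ℝ) ^ 2 * B * (F.L : ℝ) ^ (K - n) * ((∑ p : Plaq (F.P K) 0, ‖((Complex.I • X ⟨p.src, p.μ⟩) + ((W ⟨p.src, p.μ⟩ : Matrix (Fin 2) (Fin 2) ℂ) * (Complex.I • X ⟨p.src.shift p.μ, p.ν⟩) * star (W ⟨p.src, p.μ⟩ : Matrix (Fin 2) (Fin 2) ℂ))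
            - (((W ⟨p.src, p.μ⟩ * W ⟨p.src.shift p.μ, p.ν⟩ * (W ⟨p.src.shift p.ν, p.μ⟩)⁻¹ : Matrix.specialUnitaryGroup (Fin 2) ℂ) : Matrix (Fin 2) (Fin 2) ℂ) * (Complex.I • X ⟨p.src.shift p.ν, p.μ⟩) * star ((W ⟨p.src, p.μ⟩ * W ⟨p.src.shift p.μ, p.ν⟩ * (W ⟨p.src.shift p.ν, p.μ⟩)⁻¹ : Matrix.specialUnitaryGroup (Fin 2) ℂ) : Matrix (Fin 2) (Fin 2) ℂ))
            - (((GaugeField.plaqHol W p : Matrix.specialUnitaryGroup (Fin 2) ℂ) : Matrix (Fin 2) (Fin 2) ℂ) * (Complex.I • X ⟨p.src, p.ν⟩) * star ((GaugeField.plaqHol W p : Matrix.specialUnitaryGroup (Fin 2) ℂ) : Matrix (Fin 2) (Fin 2) ℂ)))‖ ^ 2) + (∑ x : Site (F.P K) 0, ∑ j : Fin 2, ∑ k : Fin 2,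
              ‖(divB (torusT (F.P K) 0) (fun κ z => unitsField (toUField W) ⟨z, κ⟩) (fun κ z => Complex.I • X ⟨z, κ⟩) x) j k‖ ^ 2)) := by
    have e3 : ∀ (M KD u v w : ℝ), w * v = u →
        220 * (F.L : ℝ) ^ 3 * (A * M) * u + 110 * (F.L : ℝ) ^ 2 * (B * KD + B' * w * M) * v
          = (220 * (F.L : ℝ) ^ 3 * A + 110 * (F.L : ℝ) ^ 2 * B') * u * M + 110 * (F.L : ℝ) ^ 2 * B * v * KD := by
      intro M KD u v w hw
      have : 110 * (F.L : ℝ) ^ 2 * (B' * w * M) * v = 110 * (F.L : ℝ) ^ 2 * B' * (w * v) * M := by ring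
      rw [mul_add (110 * (F.L : ℝ) ^ 2), add_mul, this, hw]; ring
    exact e3 _ _ _ _ _ hinv
  rw [hPc_shape] at hF3b
  -- §1 at this member
  have hmem := sum_norm_CmapTw_sub_CmapTwS_le_X_of_frameRem2 F n K hnK.le he w1 hσ0 hσL W hreg X hD hs hF3b.1 hF3b.2 hRsM hRcM
  linarith only [hmem]

-- KERNEL WITNESS (no new content): the conclusion IS ✓p698006's `hD` slot — ★p1 g18 ✓p700543 `hPA2_of_diffL1` consumes it as typed, giving the P-A2 binder from `hMc`, «REM2ˢ», «REM2ᶜ».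
example := fun hMc hRs hRc => Prop7HcoSOfNormG0DiffRow.hPA2_of_diffL1 (hD_of_hMcomb_of_rem2Rows hMc hRs hRc)

end Summit.QuantumFields.YangMills.Theorems.Prop7HDOfCombRowRem2Rows

end
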